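import Literature.Analysis.FluidPDE.Seregin2020AncientLimit
import Literature.Analysis.FluidPDE.AxisymmetricVorticityTransport
import Literature.Analysis.FluidPDE.Seregin2020SingularSetAxis
import Literature.Analysis.FluidPDE.EulerTimeScaling
import HarnessLib

/-!
# Seregin 2020, proof of Theorem 2.1: the blow-up limit of an axisymmetric solution is
# axisymmetric (property (𝒜)(ii), almost-everywhere form)

Analysis/FluidPDE proof file (everything proved; no definitions, no named facts) on the way to
the named fact `Literature.Analysis.FluidPDE.Seregin2020_axisymmetricSingularPoint_typeII`
(`Seregin2020AxisymmetricTypeII.lean`; G. Seregin, Anal. Math. Phys. 10 (2020), Paper 46 =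
arXiv:2006.04140, Thm. 2.1). Property (𝒜)(ii) of the blow-up limit `(u, p)` of the rescaled
pairs `uᵏ(y, s) = λₖ v(λₖ y, λₖ² s)`, `pᵏ = λₖ² q(λₖ y, λₖ² s)` at the origin (p. 7): "`u` and `p`
is axially symmetric solution to the Navier–Stokes equations in `Q₋`".

The rescalings are centred on the axis, so every `uᵏ`, `pᵏ` is axisymmetric on the slices it
sees; axisymmetry passes to strong `L³` limits and to weak `L^{3/2}` limits in the
almost-everywhere sense: for every rotation `R_θ` about the `x₃`-axis and every `a > 0`,
`w(s, R_θ y) = R_θ w(s, y)` and `π(s, R_θ y) = π(s, y)` for a.e. `(s, y) ∈ Q(a)`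
(`Seregin2020.ancientLimit_ae_axisymmetric`). (A pointwise axisymmetric representative, as in
the accepted `IsAxisymmetric`, can then be obtained by averaging over the rotation group; not
done here.)

## Contents (namespace `Literature.Analysis.FluidPDE.Seregin2020`)

* the space–time rotation is the map `fun z => (z.1, rotZ θ z.2)`;
  `measurePreserving_rotST`, `rotST_preimage_parabolicCylinder`,
  `measurePreserving_rotST_restrict`, `measurableEmbedding_rotST` — it preserves Lebesgue measure
  and the balls `Q(a)`;
* `ae_rot_eq_of_tendsto_eLpNorm` — axisymmetry passes to strong `L³(Q(a))` limits;
* `ae_rot_eq_of_tendsto_weakly` — invariance passes to weak `L^{3/2}(Q(a))` limits;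
* `zoom_rot`, `zoom_pressure_rot` — the rescaled pairs at the origin are axisymmetric on `Q(a)`
  once `λ a ≤ 1`;
* `ancientLimit_ae_axisymmetric` — (𝒜)(ii) for the limit of `Seregin2020.exists_ancientLimit`.

## References

* G. Seregin, Anal. Math. Phys. 10 (2020), Paper 46 = arXiv:2006.04140, proof of Thm. 2.1,
  property (𝒜)(ii). [Seregin2020]
-/

noncomputable section

open MeasureTheory Set Function Filter Topology TopologicalSpace Metric
open scoped NNReal ENNReal

namespace Literature.Analysis.FluidPDE

namespace Seregin2020

/-! ### The space–time rotation `(s, y) ↦ (s, R_θ y)` -/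

/-- The space–time rotation preserves Lebesgue measure on `ℝ × ℝ³`. [folklore] -/
theorem measurePreserving_rotST (θ : ℝ) :
    MeasurePreserving (fun z : ℝ × EuclideanSpace ℝ (Fin 3) => (z.1, rotZ θ z.2))
      (volume : Measure (ℝ × EuclideanSpace ℝ (Fin 3))) volume := by
  have h := (MeasurePreserving.id (volume : Measure ℝ)).prod (rotZLIE θ).measurePreserving
  rw [← Measure.volume_eq_prod] at h
  exact h

/-- The space–time rotation maps `Q(a)` onto itself: `Φ⁻¹(Q(a)) = Q(a)` (the balls about the
origin are rotation invariant). [folklore] -/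
theorem rotST_preimage_parabolicCylinder (θ a : ℝ) :
    (fun z : ℝ × EuclideanSpace ℝ (Fin 3) => (z.1, rotZ θ z.2)) ⁻¹'
        parabolicCylinder a (0 : ℝ × EuclideanSpace ℝ (Fin 3)) =
      parabolicCylinder a (0 : ℝ × EuclideanSpace ℝ (Fin 3)) := by
  ext z
  simp only [mem_preimage, mem_parabolicCylinder, Prod.fst_zero, Prod.snd_zero, dist_zero_right,
    norm_rotZ]

/-- The space–time rotation preserves Lebesgue measure restricted to `Q(a)`. [folklore] -/
theorem measurePreserving_rotST_restrict (θ a : ℝ) :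
    MeasurePreserving (fun z : ℝ × EuclideanSpace ℝ (Fin 3) => (z.1, rotZ θ z.2))
      (volume.restrict (parabolicCylinder a (0 : ℝ × EuclideanSpace ℝ (Fin 3))))
      (volume.restrict (parabolicCylinder a (0 : ℝ × EuclideanSpace ℝ (Fin 3)))) := by
  have h := (measurePreserving_rotST θ).restrict_preimage
    (isOpen_parabolicCylinder a (0 : ℝ × EuclideanSpace ℝ (Fin 3))).measurableSet
  rwa [rotST_preimage_parabolicCylinder] at h

/-- The space–time rotation is a measurable embedding. [folklore] -/
theorem measurableEmbedding_rotST (θ : ℝ) :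
    MeasurableEmbedding (fun z : ℝ × EuclideanSpace ℝ (Fin 3) => (z.1, rotZ θ z.2)) :=
  measurableEmbedding_prodMap_id_linearIsometryEquiv (rotZLIE θ)

/-! ### Axisymmetry passes to strong and weak limits -/

/-- **Axisymmetry passes to strong `L³` limits (a.e. form).** If `V_j → w` in `L³(Q(a))` and
every `V_j` is axisymmetric on `Q(a)`, `V_j(s, R_θ y) = R_θ V_j(s, y)`, then
`w(s, R_θ y) = R_θ w(s, y)` for a.e. `(s, y) ∈ Q(a)`. [folklore] -/
theorem ae_rot_eq_of_tendsto_eLpNorm {a : ℝ} (θ : ℝ)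
    {V : ℕ → ℝ → EuclideanSpace ℝ (Fin 3) → EuclideanSpace ℝ (Fin 3)}
    {w : ℝ → EuclideanSpace ℝ (Fin 3) → EuclideanSpace ℝ (Fin 3)}
    (hV : ∀ j, AEStronglyMeasurable (uncurry (V j))
      (volume.restrict (parabolicCylinder a (0 : ℝ × EuclideanSpace ℝ (Fin 3)))))
    (hw : AEStronglyMeasurable (uncurry w)
      (volume.restrict (parabolicCylinder a (0 : ℝ × EuclideanSpace ℝ (Fin 3)))))
    (hsym : ∀ j, ∀ z ∈ parabolicCylinder a (0 : ℝ × EuclideanSpace ℝ (Fin 3)),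
      V j z.1 (rotZ θ z.2) = rotZ θ (V j z.1 z.2))
    (hconv : Tendsto (fun j => eLpNorm (uncurry (V j) - uncurry w) 3
      (volume.restrict (parabolicCylinder a (0 : ℝ × EuclideanSpace ℝ (Fin 3))))) atTop (𝓝 0)) :
    ∀ᵐ z ∂(volume.restrict (parabolicCylinder a (0 : ℝ × EuclideanSpace ℝ (Fin 3)))),
      w z.1 (rotZ θ z.2) = rotZ θ (w z.1 z.2) := by
  set Q' := parabolicCylinder a (0 : ℝ × EuclideanSpace ℝ (Fin 3)) with hQ'
  set μ : Measure (ℝ × EuclideanSpace ℝ (Fin 3)) := volume.restrict Q' with hμ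
  set T : ℝ × EuclideanSpace ℝ (Fin 3) → ℝ × EuclideanSpace ℝ (Fin 3) :=
    fun z => (z.1, rotZ θ z.2) with hT
  have hTm : MeasurePreserving T μ μ := measurePreserving_rotST_restrict θ a
  -- the two functions to be compared
  set f : ℝ × EuclideanSpace ℝ (Fin 3) → EuclideanSpace ℝ (Fin 3) := uncurry w ∘ T with hf
  set g : ℝ × EuclideanSpace ℝ (Fin 3) → EuclideanSpace ℝ (Fin 3) :=
    fun z => rotZ θ (uncurry w z) with hg
  have hfm : AEStronglyMeasurable f μ := hw.comp_measurePreserving hTm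
  have hgm : AEStronglyMeasurable g μ :=
    (rotZLIE θ).continuous.comp_aestronglyMeasurable hw
  -- `‖f - g‖₃ ≤ 2 ‖V_j - w‖₃`
  have hle : ∀ j, eLpNorm (f - g) 3 μ ≤
      eLpNorm (uncurry (V j) - uncurry w) 3 μ + eLpNorm (uncurry (V j) - uncurry w) 3 μ := by
    intro j
    have hVT : AEStronglyMeasurable (uncurry (V j) ∘ T) μ := (hV j).comp_measurePreserving hTm
    -- first piece: `(w - V_j) ∘ T`
    have h1 : eLpNorm (f - uncurry (V j) ∘ T) 3 μ = eLpNorm (uncurry (V j) - uncurry w) 3 μ := by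
      have e : f - uncurry (V j) ∘ T = (uncurry w - uncurry (V j)) ∘ T := by
        funext z; rfl
      rw [e, eLpNorm_comp_measurePreserving (hw.sub (hV j)) hTm, ← eLpNorm_neg, neg_sub]
    -- second piece: `V_j ∘ T - R ∘ w = R ∘ (V_j - w)` a.e.
    have h2 : eLpNorm (uncurry (V j) ∘ T - g) 3 μ = eLpNorm (uncurry (V j) - uncurry w) 3 μ := by
      refine eLpNorm_congr_norm_ae ?_
      filter_upwards [ae_restrict_mem (isOpen_parabolicCylinder a _).measurableSet] with z hz
      simp only [Pi.sub_apply, comp_apply, hg]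
      show ‖V j z.1 (rotZ θ z.2) - rotZ θ (uncurry w z)‖ = ‖V j z.1 z.2 - w z.1 z.2‖
      have hlin : rotZ θ (V j z.1 z.2) - rotZ θ (w z.1 z.2) = rotZ θ (V j z.1 z.2 - w z.1 z.2) := by
        rw [← rotZL_apply, ← rotZL_apply, ← rotZL_apply, map_sub]
      rw [hsym j z hz, show uncurry w z = w z.1 z.2 from rfl, hlin, norm_rotZ]
    calc eLpNorm (f - g) 3 μ = eLpNorm ((f - uncurry (V j) ∘ T) + (uncurry (V j) ∘ T - g)) 3 μ := by
          rw [sub_add_sub_cancel]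
      _ ≤ eLpNorm (f - uncurry (V j) ∘ T) 3 μ + eLpNorm (uncurry (V j) ∘ T - g) 3 μ :=
          eLpNorm_add_le (hfm.sub hVT) (hVT.sub hgm) (by norm_num)
      _ = _ := by rw [h1, h2]
  have hlim : Tendsto (fun j => eLpNorm (uncurry (V j) - uncurry w) 3 μ +
      eLpNorm (uncurry (V j) - uncurry w) 3 μ) atTop (𝓝 0) := by
    have := hconv.add hconv
    rwa [add_zero] at this
  have h0 : eLpNorm (f - g) 3 μ = 0 :=
    le_antisymm (ge_of_tendsto' hlim hle) bot_le
  have hae : f - g =ᵐ[μ] 0 := (eLpNorm_eq_zero_iff (hfm.sub hgm) (by norm_num)).1 h0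
  filter_upwards [hae] with z hz
  have hz' : f z - g z = 0 := hz
  rw [sub_eq_zero] at hz'
  exact hz'

/-- **Rotation invariance passes to weak `L^{3/2}` limits (a.e. form).** If the pairings
`∫_{Q(a)} P_j g → ∫_{Q(a)} π g` for all `g ∈ L³(Q(a))`, `π ∈ L^{3/2}(Q(a))`, and every `P_j` is
rotation invariant on `Q(a)`, then `π(s, R_θ y) = π(s, y)` for a.e. `(s, y) ∈ Q(a)`. [folklore] -/
theorem ae_rot_eq_of_tendsto_weakly {a : ℝ} (θ : ℝ)
    {P : ℕ → ℝ → EuclideanSpace ℝ (Fin 3) → ℝ} {π : ℝ → EuclideanSpace ℝ (Fin 3) → ℝ}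
    (hπ : MemLp (uncurry π) (3 / 2)
      (volume.restrict (parabolicCylinder a (0 : ℝ × EuclideanSpace ℝ (Fin 3)))))
    (hsym : ∀ j, ∀ z ∈ parabolicCylinder a (0 : ℝ × EuclideanSpace ℝ (Fin 3)),
      P j z.1 (rotZ θ z.2) = P j z.1 z.2)
    (hweak : ∀ g : ℝ × EuclideanSpace ℝ (Fin 3) → ℝ,
      MemLp g 3 (volume.restrict (parabolicCylinder a (0 : ℝ × EuclideanSpace ℝ (Fin 3)))) →
      Tendsto (fun j => ∫ z in parabolicCylinder a (0 : ℝ × EuclideanSpace ℝ (Fin 3)),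
          P j z.1 z.2 * g z) atTop
        (𝓝 (∫ z in parabolicCylinder a (0 : ℝ × EuclideanSpace ℝ (Fin 3)), π z.1 z.2 * g z))) :
    ∀ᵐ z ∂(volume.restrict (parabolicCylinder a (0 : ℝ × EuclideanSpace ℝ (Fin 3)))),
      π z.1 (rotZ θ z.2) = π z.1 z.2 := by
  set Q' := parabolicCylinder a (0 : ℝ × EuclideanSpace ℝ (Fin 3)) with hQ'
  set μ : Measure (ℝ × EuclideanSpace ℝ (Fin 3)) := volume.restrict Q' with hμ
  set T : ℝ × EuclideanSpace ℝ (Fin 3) → ℝ × EuclideanSpace ℝ (Fin 3) :=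
    fun z => (z.1, rotZ θ z.2) with hT
  set T' : ℝ × EuclideanSpace ℝ (Fin 3) → ℝ × EuclideanSpace ℝ (Fin 3) :=
    fun z => (z.1, rotZ (-θ) z.2) with hT'
  have hTm : MeasurePreserving T μ μ := measurePreserving_rotST_restrict θ a
  have hT'm : MeasurePreserving T' μ μ := measurePreserving_rotST_restrict (-θ) a
  have hTe : MeasurableEmbedding T := measurableEmbedding_rotST θ
  have hT'e : MeasurableEmbedding T' := measurableEmbedding_rotST (-θ)
  -- the rotated pressure
  set πT : ℝ → EuclideanSpace ℝ (Fin 3) → ℝ := fun s y => π s (rotZ θ y) with hπT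
  have hπTu : uncurry πT = uncurry π ∘ T := by funext z; rfl
  have hπT_mem : MemLp (uncurry πT) (3 / 2) μ := by
    rw [hπTu]; exact hπ.comp_measurePreserving hTm
  -- equality of all pairings
  have key : ∀ g : ℝ × EuclideanSpace ℝ (Fin 3) → ℝ, MemLp g 3 μ →
      ∫ z in Q', πT z.1 z.2 * g z = ∫ z in Q', π z.1 z.2 * g z := by
    intro g hg
    have hgT' : MemLp (g ∘ T') 3 μ := hg.comp_measurePreserving hT'm
    have hT'T : ∀ z, T' (T z) = z := fun z => by
      show (z.1, rotZ (-θ) (rotZ θ z.2)) = z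
      rw [← rotZ_add, neg_add_cancel, rotZ_zero]
    -- `∫ (π ∘ T) g = ∫ π (g ∘ T')`
    have e1 : ∫ z in Q', πT z.1 z.2 * g z = ∫ z in Q', π z.1 z.2 * (g ∘ T') z := by
      have h := hTm.integral_comp hTe (fun z => π z.1 z.2 * (g ∘ T') z)
      refine Eq.trans ?_ h
      refine integral_congr_ae (ae_of_all _ fun z => ?_)
      show π z.1 (rotZ θ z.2) * g z = π (T z).1 (T z).2 * g (T' (T z))
      rw [hT'T]
    -- `∫ P_j (g ∘ T') = ∫ P_j g` by the invariance of `P_j`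
    have e2 : ∀ j, ∫ z in Q', P j z.1 z.2 * (g ∘ T') z = ∫ z in Q', P j z.1 z.2 * g z := by
      intro j
      have h := hTm.integral_comp hTe (fun z => P j z.1 z.2 * (g ∘ T') z)
      rw [← h]
      refine integral_congr_ae ?_
      filter_upwards [ae_restrict_mem (isOpen_parabolicCylinder a _).measurableSet] with z hz
      show P j z.1 (rotZ θ z.2) * g (T' (T z)) = P j z.1 z.2 * g z
      rw [hsym j z hz, hT'T]
    have h3 := (hweak (g ∘ T') hgT').congr e2
    have h4 := hweak g hg
    rw [e1]
    exact tendsto_nhds_unique h3 h4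
  have hae := ae_eq_of_forall_setIntegral_mul_eq hπT_mem hπ key
  filter_upwards [hae] with z hz
  exact hz

/-! ### The rescaled pairs at the origin are axisymmetric -/

/-- For `z ∈ Q(a)` and `c a ≤ 1` the rescaled time `c² z.1` lies in `]-1, 0[`. [folklore] -/
theorem sq_mul_fst_mem_Ioo {a c : ℝ} (hc : 0 < c) (hca : c * a ≤ 1)
    {z : ℝ × EuclideanSpace ℝ (Fin 3)}
    (hz : z ∈ parabolicCylinder a (0 : ℝ × EuclideanSpace ℝ (Fin 3))) :
    c ^ 2 * z.1 ∈ Ioo (-1 : ℝ) 0 := by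
  rw [mem_parabolicCylinder] at hz
  obtain ⟨⟨h1, h2⟩, h3⟩ := hz
  simp only [Prod.fst_zero, zero_sub] at h1 h2
  have ha : 0 < a := lt_of_le_of_lt dist_nonneg h3
  have hc2 : 0 < c ^ 2 := by positivity
  refine ⟨?_, mul_neg_of_pos_of_neg hc2 h2⟩
  have h4 : (c * a) ^ 2 ≤ 1 := pow_le_one₀ (by positivity) hca
  have h5 : c ^ 2 * a ^ 2 ≤ 1 := by rw [← mul_pow]; exact h4
  nlinarith [mul_lt_mul_of_pos_left h1 hc2]

/-- **The rescaled velocities at the origin are axisymmetric**: if every slice `u(t)`,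
`-1 < t < 0`, is axisymmetric, then so is every slice of `c u(c² s, c y)` on `Q(a)` as soon as
`c a ≤ 1` (the rescaling is centred on the axis and commutes with the rotations). [cite: Seregin2020, proof of Thm. 2.1, property (𝒜)(ii)] -/
theorem zoom_rot {u : ℝ → EuclideanSpace ℝ (Fin 3) → EuclideanSpace ℝ (Fin 3)}
    (hu_ax : ∀ t ∈ Ioo (-1 : ℝ) 0, IsAxisymmetric (u t)) {a c : ℝ} (hc : 0 < c) (hca : c * a ≤ 1)
    (θ : ℝ) {z : ℝ × EuclideanSpace ℝ (Fin 3)}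
    (hz : z ∈ parabolicCylinder a (0 : ℝ × EuclideanSpace ℝ (Fin 3))) :
    (c • stPull (c ^ 2) c (0 : ℝ) (0 : EuclideanSpace ℝ (Fin 3)) u) z.1 (rotZ θ z.2) =
      rotZ θ ((c • stPull (c ^ 2) c (0 : ℝ) (0 : EuclideanSpace ℝ (Fin 3)) u) z.1 z.2) := by
  rw [smul_stPull_apply, smul_stPull_apply, zero_add, zero_add, zero_add, ← rotZ_smul,
    hu_ax _ (sq_mul_fst_mem_Ioo hc hca hz) θ, rotZ_smul]

/-- **The rescaled pressures at the origin are rotation invariant** (same statement for the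
scalar `c² p(c² s, c y)`). [cite: Seregin2020, proof of Thm. 2.1, property (𝒜)(ii)] -/
theorem zoom_pressure_rot {p : ℝ → EuclideanSpace ℝ (Fin 3) → ℝ}
    (hp_ax : ∀ t ∈ Ioo (-1 : ℝ) 0, IsAxisymmetricScalar (p t)) {a c : ℝ} (hc : 0 < c)
    (hca : c * a ≤ 1) (θ : ℝ) {z : ℝ × EuclideanSpace ℝ (Fin 3)}
    (hz : z ∈ parabolicCylinder a (0 : ℝ × EuclideanSpace ℝ (Fin 3))) :
    (c ^ 2 • stPull (c ^ 2) c (0 : ℝ) (0 : EuclideanSpace ℝ (Fin 3)) p) z.1 (rotZ θ z.2) =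
      (c ^ 2 • stPull (c ^ 2) c (0 : ℝ) (0 : EuclideanSpace ℝ (Fin 3)) p) z.1 z.2 := by
  rw [smul_stPull_apply, smul_stPull_apply, zero_add, zero_add, zero_add, ← rotZ_smul,
    hp_ax _ (sq_mul_fst_mem_Ioo hc hca hz) θ]

/-! ### (𝒜)(ii): the blow-up limit is axisymmetric almost everywhere -/

/-- **Seregin 2020, proof of Thm. 2.1, property (𝒜)(ii) of the blow-up limit (a.e. form).**
Under the hypotheses of Theorem 2.1 (including the axial symmetry of all slices `u(t)`, `p(t)`,
`-1 < t < 0`) and the Type I assumption `g(0) < ∞`, the blow-up limit `(w, π)` of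
`exists_ancientLimit` may be taken axisymmetric almost everywhere: in addition to all the
properties listed there, for every rotation `R_θ` about the axis and every `a > 0`,
`w(s, R_θ y) = R_θ w(s, y)` and `π(s, R_θ y) = π(s, y)` for a.e. `(s, y) ∈ Q(a)`.
[cite: Seregin2020, proof of Thm. 2.1, properties (𝒜)(i)–(iii) and (2.9)] -/
theorem exists_ancientLimit_axisymmetric
    {u : ℝ → EuclideanSpace ℝ (Fin 3) → EuclideanSpace ℝ (Fin 3)}
    {p : ℝ → EuclideanSpace ℝ (Fin 3) → ℝ}
    {G : ℝ → EuclideanSpace ℝ (Fin 3) → EuclideanSpace ℝ (Fin 3) →L[ℝ] EuclideanSpace ℝ (Fin 3)}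
    (hsw : IsSuitableWeakSolutionOn (SereginSverak2009.parCylOpens 0 1) 1 0 u p)
    (hA : ∃ C : ℝ≥0, ∀ᵐ t ∂(volume.restrict (Ioo (-1 : ℝ) 0)),
      ∫⁻ x in SereginSverak2009.spaceCyl 0 1, ‖u t x‖ₑ ^ 2 ≤ C)
    (hG : HasWeakSpatialGradientOn (SereginSverak2009.parCylOpens 0 1) u G)
    (hE : ∫⁻ z in SereginSverak2009.parCyl 0 1, ENNReal.ofReal (frobeniusNormSq (G z.1 z.2)) < ∞)
    (hp : ∫⁻ z in SereginSverak2009.parCyl 0 1, ‖p z.1 z.2‖ₑ ^ (3 / 2 : ℝ) < ∞)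
    (hu_ax : ∀ t ∈ Ioo (-1 : ℝ) 0, IsAxisymmetric (u t))
    (hp_ax : ∀ t ∈ Ioo (-1 : ℝ) 0, IsAxisymmetricScalar (p t))
    (hsing : IsBackwardSingularPoint u 0) (hI : blowupIndex 0 u G < ∞) :
    ∃ (K : ℝ≥0) (κ : ℝ) (lam : ℕ → ℝ)
      (w : ℝ → EuclideanSpace ℝ (Fin 3) → EuclideanSpace ℝ (Fin 3))
      (π : ℝ → EuclideanSpace ℝ (Fin 3) → ℝ),
      0 < κ ∧ (∀ j, 0 < lam j) ∧ Tendsto lam atTop (𝓝 0) ∧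
      IsBackwardSingularPoint w 0 ∧
      (∀ a : ℝ, 0 < a →
        IsSuitableWeakSolutionInBall a 0 w π ∧
        MemLp (uncurry w) 3
          (volume.restrict (parabolicCylinder a (0 : ℝ × EuclideanSpace ℝ (Fin 3)))) ∧
        Tendsto (fun j => eLpNorm
            (uncurry ((lam j) • stPull ((lam j) ^ 2) (lam j) (0 : ℝ)
              (0 : EuclideanSpace ℝ (Fin 3)) u) - uncurry w) 3
            (volume.restrict (parabolicCylinder a (0 : ℝ × EuclideanSpace ℝ (Fin 3)))))
          atTop (𝓝 0) ∧
        (∀ g : ℝ × EuclideanSpace ℝ (Fin 3) → ℝ,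
          MemLp g 3 (volume.restrict (parabolicCylinder a (0 : ℝ × EuclideanSpace ℝ (Fin 3)))) →
          Tendsto (fun j => ∫ w' in parabolicCylinder a (0 : ℝ × EuclideanSpace ℝ (Fin 3)),
              ((lam j) ^ 2 • stPull ((lam j) ^ 2) (lam j) (0 : ℝ)
                (0 : EuclideanSpace ℝ (Fin 3)) p) w'.1 w'.2 * g w')
            atTop (𝓝 (∫ w' in parabolicCylinder a (0 : ℝ × EuclideanSpace ℝ (Fin 3)),
              π w'.1 w'.2 * g w'))) ∧
        cknAEss a (0 : ℝ × EuclideanSpace ℝ (Fin 3)) w ≤ K ∧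
        cknC a (0 : ℝ × EuclideanSpace ℝ (Fin 3)) w ≤ K ∧
        cknD a (0 : ℝ × EuclideanSpace ℝ (Fin 3)) π ≤ K ∧
        ENNReal.ofReal κ ≤ cknC a (0 : ℝ × EuclideanSpace ℝ (Fin 3)) w) ∧
      ∀ (θ a : ℝ), 0 < a →
        (∀ᵐ z ∂(volume.restrict (parabolicCylinder a (0 : ℝ × EuclideanSpace ℝ (Fin 3)))),
          w z.1 (rotZ θ z.2) = rotZ θ (w z.1 z.2)) ∧
        (∀ᵐ z ∂(volume.restrict (parabolicCylinder a (0 : ℝ × EuclideanSpace ℝ (Fin 3)))),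
          π z.1 (rotZ θ z.2) = π z.1 z.2) := by
  obtain ⟨K, κ, lam, w, π, hκ, hlam, hlam0, hsingw, hall⟩ :=
    exists_ancientLimit hsw hA hG hE hp hsing hI
  refine ⟨K, κ, lam, w, π, hκ, hlam, hlam0, hsingw, hall, fun θ a ha => ?_⟩
  obtain ⟨h1, h2, h3, h4, -⟩ := hall a ha
  -- measurability of `u` on `Q(1/2)`
  have hQ : parabolicCylinder 1 (0 : ℝ × EuclideanSpace ℝ (Fin 3)) ⊆
      ((SereginSverak2009.parCylOpens 0 1 : Opens (ℝ × EuclideanSpace ℝ (Fin 3))) :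
        Set (ℝ × EuclideanSpace ℝ (Fin 3))) := by
    rw [SereginSverak2009.coe_parCylOpens]
    exact parabolicCylinder_subset_parCyl 0 1
  have hu_meas : AEStronglyMeasurable (uncurry u)
      (volume.restrict (parabolicCylinder (1 / 2)
        (((0 : ℝ), (0 : EuclideanSpace ℝ (Fin 3))) : ℝ × EuclideanSpace ℝ (Fin 3)))) := by
    refine (hG.locallyIntegrableOn.aestronglyMeasurable).mono_measure (Measure.restrict_mono ?_ le_rfl)
    exact (parabolicCylinder_mono (by norm_num) (by norm_num) _).trans hQ
  -- indices with `λⱼ a ≤ 1/2`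
  have hev : ∀ᶠ j in atTop, lam j * a ≤ 1 / 2 := by
    have h := hlam0.mul_const a
    rw [zero_mul] at h
    exact (h.eventually (ge_mem_nhds (by norm_num : (0 : ℝ) < 1 / 2))).mono fun j hj => hj
  obtain ⟨j₀, hj₀⟩ := eventually_atTop.1 hev
  have hj₀' : ∀ j, lam (j + j₀) * a ≤ 1 := fun j => by
    have := hj₀ (j + j₀) (Nat.le_add_left _ _); linarith
  have hj₀'' : ∀ j, a * lam (j + j₀) ≤ 1 / 2 := fun j => by
    rw [mul_comm]; exact hj₀ (j + j₀) (Nat.le_add_left _ _)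
  refine ⟨?_, ?_⟩
  · -- the velocity
    have hV : ∀ j, AEStronglyMeasurable
        (uncurry ((lam (j + j₀)) • stPull ((lam (j + j₀)) ^ 2) (lam (j + j₀)) (0 : ℝ)
          (0 : EuclideanSpace ℝ (Fin 3)) u))
        (volume.restrict (parabolicCylinder a (0 : ℝ × EuclideanSpace ℝ (Fin 3)))) := fun j =>
      aestronglyMeasurable_uncurry_zoom_of hu_meas (hlam _) ha (hj₀'' j)
    have h3' := (tendsto_add_atTop_iff_nat (f := fun j => eLpNorm
        (uncurry ((lam j) • stPull ((lam j) ^ 2) (lam j) (0 : ℝ) (0 : EuclideanSpace ℝ (Fin 3)) u) -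
          uncurry w) 3
        (volume.restrict (parabolicCylinder a (0 : ℝ × EuclideanSpace ℝ (Fin 3))))) j₀).2 h3
    exact ae_rot_eq_of_tendsto_eLpNorm θ hV h2.1
      (fun j z hz => zoom_rot hu_ax (hlam _) (hj₀' j) θ hz) h3'
  · -- the pressure
    have h4' : ∀ g : ℝ × EuclideanSpace ℝ (Fin 3) → ℝ,
        MemLp g 3 (volume.restrict (parabolicCylinder a (0 : ℝ × EuclideanSpace ℝ (Fin 3)))) →
        Tendsto (fun j => ∫ w' in parabolicCylinder a (0 : ℝ × EuclideanSpace ℝ (Fin 3)),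
            ((lam (j + j₀)) ^ 2 • stPull ((lam (j + j₀)) ^ 2) (lam (j + j₀)) (0 : ℝ)
              (0 : EuclideanSpace ℝ (Fin 3)) p) w'.1 w'.2 * g w')
          atTop (𝓝 (∫ w' in parabolicCylinder a (0 : ℝ × EuclideanSpace ℝ (Fin 3)),
            π w'.1 w'.2 * g w')) := fun g hg =>
      (tendsto_add_atTop_iff_nat (f := fun j => ∫ w' in parabolicCylinder a
        (0 : ℝ × EuclideanSpace ℝ (Fin 3)),
          ((lam j) ^ 2 • stPull ((lam j) ^ 2) (lam j) (0 : ℝ) (0 : EuclideanSpace ℝ (Fin 3)) p)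
            w'.1 w'.2 * g w') j₀).2 (h4 g hg)
    exact ae_rot_eq_of_tendsto_weakly θ h1.2.2.2
      (fun j z hz => zoom_pressure_rot hp_ax (hlam _) (hj₀' j) θ hz) h4'

/-! ### (𝒜)(iii) for `E`: the dissipation of the limit is bounded on every ball -/

/-- **The dissipation bound of the blow-up limit** ((𝒜)(iii) for `E`). If `(w, π)` is a suitable
weak solution in every `Q(a)`, `a > 0`, with `C(w; a) ≤ K` and `D(π; a) ≤ K` for all `a > 0` (as
for the limit of `exists_ancientLimit`), then there is `K' < ∞` such that for every `a > 0` the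
weak spatial gradient `G_a` of `w` in `Q(2a)` satisfies `A(w; a) + E(G_a; a) ≤ K'` (the local
energy bound `Seregin2020.localEnergyBound_top` on `Q(2a)`).
[cite: Seregin2020, proof of Thm. 2.1, property (𝒜)(iii)] -/
theorem exists_cknE_bound_of_forall_inBall
    {w : ℝ → EuclideanSpace ℝ (Fin 3) → EuclideanSpace ℝ (Fin 3)}
    {π : ℝ → EuclideanSpace ℝ (Fin 3) → ℝ} {K : ℝ≥0}
    (hlim : ∀ a : ℝ, 0 < a →
      IsSuitableWeakSolutionInBall a 0 w π ∧
        cknC a (0 : ℝ × EuclideanSpace ℝ (Fin 3)) w ≤ K ∧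
          cknD a (0 : ℝ × EuclideanSpace ℝ (Fin 3)) π ≤ K) :
    ∃ K' : ℝ≥0, ∀ a : ℝ, 0 < a →
      ∃ G' : ℝ → EuclideanSpace ℝ (Fin 3) → EuclideanSpace ℝ (Fin 3) →L[ℝ] EuclideanSpace ℝ (Fin 3),
        HasWeakSpatialGradientOn (parabolicCylinderOpens (2 * a) (0 : ℝ × EuclideanSpace ℝ (Fin 3))) w G' ∧
        cknAEss a (0 : ℝ × EuclideanSpace ℝ (Fin 3)) w + cknE a (0 : ℝ × EuclideanSpace ℝ (Fin 3)) G' ≤ K' := by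
  obtain ⟨c₁, c₂, c₃, H⟩ := localEnergyBound_top
  set B : ℝ≥0∞ := c₁ * (K : ℝ≥0∞) ^ (2 / 3 : ℝ) + c₂ * K +
    c₃ * ((K : ℝ≥0∞) ^ (2 / 3 : ℝ) * (K : ℝ≥0∞) ^ (1 / 3 : ℝ)) with hB
  have hBtop : B ≠ ∞ := by
    have h1 : (K : ℝ≥0∞) ^ (2 / 3 : ℝ) ≠ ∞ := ENNReal.rpow_ne_top_of_nonneg (by norm_num) ENNReal.coe_ne_top
    have h2 : (K : ℝ≥0∞) ^ (1 / 3 : ℝ) ≠ ∞ := ENNReal.rpow_ne_top_of_nonneg (by norm_num) ENNReal.coe_ne_top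
    exact ENNReal.add_ne_top.2 ⟨ENNReal.add_ne_top.2 ⟨ENNReal.mul_ne_top ENNReal.coe_ne_top h1,
      ENNReal.mul_ne_top ENNReal.coe_ne_top ENNReal.coe_ne_top⟩,
      ENNReal.mul_ne_top ENNReal.coe_ne_top (ENNReal.mul_ne_top h1 h2)⟩
  refine ⟨B.toNNReal, fun a ha => ?_⟩
  obtain ⟨hball, hC, hD⟩ := hlim (2 * a) (by positivity)
  obtain ⟨hsw, -, ⟨G', hG', -⟩, -⟩ := hball
  refine ⟨G', hG', ?_⟩
  have key := H _ w π G' hsw hG' 0 (2 * a) (by positivity) subset_rfl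
  rw [show 2 * a / 2 = a by ring] at key
  rw [ENNReal.coe_toNNReal hBtop]
  refine key.trans ?_
  rw [hB]
  gcongr

end Seregin2020

end Literature.Analysis.FluidPDE

end
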